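import Summits.NavierStokesRegularity.NavierStokesRegularity.Theses.AxisymmetricExtremality
import Summits.NavierStokesRegularity.NavierStokesRegularity.Theorems.AxisymmetricExtremalityPFoldToAxisymmetric
import Literature.Analysis.FluidPDE.HomSobolevRepresentedL3

/-!
# `MinimalDatumPFold` (crux stmt-NavierStokesRegularity-15452, route AxisymmetricExtremality) —
# negative-side support: vacuity certificates and load-bearing hypotheses (cdisprove seat, cycle 1)

The crux: for every `ν > 0`, if Clay (A) fails at `ν` then for every `N` there are `p ≥ max(N,2)`
and a Rusin–Šverák minimal blow-up datum `(u₀, g)` with `u₀` equivariant under the rotation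
`R_{2π/p}` about the `x₂`-axis. This file records, sorry-free and without new definitions or
notations (the crux body, its Clay-failure antecedent and its conclusion are WRITTEN OUT exactly as
in the route file, so every statement bridges to `MinimalDatumPFold` by `Iff.rfl`), the findings of
`Cruxes/MinimalDatumPFold/Disproof.lean` §§1, 2, 4:

* §1 VACUITY CERTIFICATES — why no refutation exists short of `¬ Clay (A)`. Under the summit the
  Clay-failure antecedent is unsatisfiable at every `ν > 0` (`not_clayFails_of_navierStokesRegularity`),
  so the crux body holds vacuously (`cruxBody_of_navierStokesRegularity`) and so does the registered
  signature of the open stub `stub_symmGapClosing` (`symmGapClosingBody_of_navierStokesRegularity`);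
  and, composing with the PROVED sibling crux `PFoldToAxisymmetric`, the crux body is equivalent to
  "Clay failure at `ν` ⇒ an AXISYMMETRIC minimal blow-up datum at `ν`" (`cruxBody_iff_axisymmetricForm`):
  a refutation must exhibit blow-up AND prove that no Rusin–Šverák minimiser is axisymmetric.
* §2 LOAD-BEARING HYPOTHESES. Dropping the Clay-failure antecedent asserts minimal blow-up data —
  hence `ρ_max^pure(ν) < ⊤` — at EVERY `ν > 0` (`withoutClayFailure_forces_minimalBlowup`,
  `withoutClayFailure_forces_thresholdFinite`); that antecedent-free form is false as soon as ONE
  viscosity is Kato-regular (`minimalDatumPFold_false_without_clayFailure_of_katoRegular`;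
  Kato-regularity at `ν` is `ρ_max^pure(ν) = ⊤`, `katoRegular_iff_threshold_top`). The binder `2 ≤ p`
  only excludes the identity rotation (`isPFold_one`).
* §4 CLAUSE MUTATION of the open stub's conclusion: without the blow-up clause it is witnessed by
  the zero datum (`symmGap_conclusion_trivial_without_blowup`); without the equivariance clause it
  is the unfolding of the threshold (`exists_blowupDatum_norm_lt_of_thresholdFinite`). The open
  content of `stub_symmGapClosing` is exactly the COUPLING near-minimal ∧ symmetric.

(§3, the refuted abstract strengthening `not_abstractExtremality`, is the companion file
`Negative/AbstractExtremalityFalse.lean`.)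

## References

* W. Rusin, V. Šverák, J. Funct. Anal. 260 (2011) 879–891 = arXiv:0911.0500, Cor. 4.3. [RusinSverak2011]
-/

set_option linter.dupNamespace false

noncomputable section

open MeasureTheory Set Function Filter Topology
open scoped ENNReal NNReal
open Literature.Analysis.FluidPDE Literature.Analysis.FunctionSpaces
open Summit.NavierStokesRegularity.NavierStokesRegularity.Theses.AxisymmetricExtremality

namespace Summit.NavierStokesRegularity.NavierStokesRegularity.Theorems.MinimalDatumPFold.Negative

/-! ## §1 Vacuity certificates: no refutation short of `¬ Clay (A)` -/

/-- Under the summit, the Clay-failure antecedent of the crux is unsatisfiable at every `ν > 0`.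
[folklore] -/
theorem not_clayFails_of_navierStokesRegularity (hS : NavierStokesRegularity) (ν : ℝ) (hν : 0 < ν) :
    ¬ (∃ v₀ : EuclideanSpace ℝ (Fin 3) → EuclideanSpace ℝ (Fin 3), ContDiff ℝ (⊤ : ℕ∞) v₀ ∧
      NSWave0.IsDivFree v₀ ∧ HasRapidSpatialDecay v₀ ∧
      ¬ ∃ (u : ℝ → EuclideanSpace ℝ (Fin 3) → EuclideanSpace ℝ (Fin 3)) (p : ℝ → EuclideanSpace ℝ (Fin 3) → ℝ),
        IsSmoothOnHalfSpace u ∧ IsSmoothOnHalfSpace p ∧ IsNavierStokesSolution ν 0 v₀ u p ∧ HasBoundedEnergy u) := by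
  intro hfail
  obtain ⟨v₀, hsm, hdiv, hdec, hno⟩ := hfail
  have h' : Literature.NS.NavierStokesExistenceSmoothR3 := hS
  exact hno (h' ν hν v₀ hsm hdiv hdec)

/-- **The crux is vacuously true under the summit**: its body (written out; `Iff.rfl` with
`MinimalDatumPFold`) follows from `NavierStokesRegularity` because the antecedent is the negated Clay
conclusion for one datum. Hence a disproof of the crux is a disproof of Clay (A). (A vacuity
certificate about the STATEMENT, not mathematics towards it.) [folklore] -/
theorem cruxBody_of_navierStokesRegularity (hS : NavierStokesRegularity) :
    ∀ ν : ℝ, 0 < ν → (∃ v₀ : EuclideanSpace ℝ (Fin 3) → EuclideanSpace ℝ (Fin 3), ContDiff ℝ (⊤ : ℕ∞) v₀ ∧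
      NSWave0.IsDivFree v₀ ∧ HasRapidSpatialDecay v₀ ∧
      ¬ ∃ (u : ℝ → EuclideanSpace ℝ (Fin 3) → EuclideanSpace ℝ (Fin 3)) (p : ℝ → EuclideanSpace ℝ (Fin 3) → ℝ),
        IsSmoothOnHalfSpace u ∧ IsSmoothOnHalfSpace p ∧ IsNavierStokesSolution ν 0 v₀ u p ∧ HasBoundedEnergy u) → (∀ N : ℕ, ∃ p : ℕ, N ≤ p ∧ 2 ≤ p ∧
      ∃ (u₀ : EuclideanSpace ℝ (Fin 3) → EuclideanSpace ℝ (Fin 3))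
        (g : HomSobolev (EuclideanSpace ℝ (Fin 3)) (EuclideanSpace ℂ (Fin 3)) (1 / 2 : ℝ)),
        IsMinimalBlowupDatum ν u₀ g ∧ ∀ x : EuclideanSpace ℝ (Fin 3),
          u₀ (WithLp.toLp 2 ![Real.cos (2 * Real.pi / p) * x 0 - Real.sin (2 * Real.pi / p) * x 1,
            Real.sin (2 * Real.pi / p) * x 0 + Real.cos (2 * Real.pi / p) * x 1, x 2]) =
          WithLp.toLp 2 ![Real.cos (2 * Real.pi / p) * u₀ x 0 - Real.sin (2 * Real.pi / p) * u₀ x 1,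
            Real.sin (2 * Real.pi / p) * u₀ x 0 + Real.cos (2 * Real.pi / p) * u₀ x 1, u₀ x 2]) :=
  fun ν hν hfail => absurd hfail (not_clayFails_of_navierStokesRegularity hS ν hν)

/-- **The open stub `stub_symmGapClosing` of line `symmetric-gap` (its registered signature verbatim —
child 1 `SymmGapClosing` of the landed split) is equally VACUOUS under the summit**, hence equally
irrefutable short of `¬ Clay (A)`: same antecedent. (A vacuity certificate, not a proof of the stub: the
hypothesis is the summit statement itself.) [folklore] -/
theorem symmGapClosingBody_of_navierStokesRegularity (hS : NavierStokesRegularity) :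
    (∀ ν : ℝ, 0 < ν → (∃ v₀ : EuclideanSpace ℝ (Fin 3) → EuclideanSpace ℝ (Fin 3), ContDiff ℝ (⊤ : ℕ∞) v₀ ∧
      Literature.Analysis.FluidPDE.NSWave0.IsDivFree v₀ ∧ Literature.Analysis.FluidPDE.HasRapidSpatialDecay v₀
      ∧ ¬ ∃ (u : ℝ → EuclideanSpace ℝ (Fin 3) → EuclideanSpace ℝ (Fin 3)) (p : ℝ → EuclideanSpace ℝ (Fin 3) →
      ℝ), Literature.Analysis.FluidPDE.IsSmoothOnHalfSpace u ∧
      Literature.Analysis.FluidPDE.IsSmoothOnHalfSpace p ∧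
      Literature.Analysis.FluidPDE.IsNavierStokesSolution ν 0 v₀ u p ∧
      Literature.Analysis.FluidPDE.HasBoundedEnergy u) → ∀ N : ℕ, ∃ p : ℕ, N ≤ p ∧ 2 ≤ p ∧ ∀ ε : ENNReal,
      0 < ε → ∃ (u₀ : EuclideanSpace ℝ (Fin 3) →
      EuclideanSpace ℝ (Fin 3)) (g : Literature.Analysis.FunctionSpaces.HomSobolev (EuclideanSpace ℝ (Fin 3)) (EuclideanSpace ℂ (Fin 3)) (1 / 2 : ℝ))
      , MeasureTheory.MemLp u₀ 3 (MeasureTheory.volume : MeasureTheory.Measure (EuclideanSpace ℝ (Fin 3))) ∧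
      g.Represents (Literature.Analysis.FunctionSpaces.EuclideanSpace.complexify ∘ u₀) ∧
      Literature.Analysis.FluidPDE.IsWeaklyDivFree u₀ ∧
      ¬ Literature.Analysis.FluidPDE.HasGlobalKatoSolution ν u₀ ∧
      ‖g‖ₑ < Literature.Analysis.FluidPDE.rusinSverakRhoMaxPure ν + ε ∧
      ∀ᵐ x ∂(MeasureTheory.volume : MeasureTheory.Measure (EuclideanSpace ℝ (Fin 3))),
      u₀ (WithLp.toLp 2 ![Real.cos (2 * Real.pi / p) * x 0 - Real.sin (2 * Real.pi / p) * x 1,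
      Real.sin (2 * Real.pi / p) * x 0 + Real.cos (2 * Real.pi / p) * x 1,
      x 2]) = WithLp.toLp 2 ![Real.cos (2 * Real.pi / p) * u₀ x 0 - Real.sin (2 * Real.pi / p) * u₀ x 1,
      Real.sin (2 * Real.pi / p) * u₀ x 0 + Real.cos (2 * Real.pi / p) * u₀ x 1, u₀ x 2]) := by
  intro ν hν hfail
  obtain ⟨v₀, hsm, hdiv, hdec, hno⟩ := hfail
  have h' : Literature.NS.NavierStokesExistenceSmoothR3 := hS
  exact absurd (h' ν hν v₀ hsm hdiv hdec) hno

/-- **Normal form via the PROVED sibling crux `PFoldToAxisymmetric`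
(`Theorems.axisymmetricExtremality_pFoldToAxisymmetric_proof`).** The crux — its body written out on the
left, `Iff.rfl` with `MinimalDatumPFold` — is EQUIVALENT to: whenever Clay (A) fails at `ν`, an
AXISYMMETRIC Rusin–Šverák minimal blow-up datum exists (`ρ_ax = ρ_max`, attained). So refuting the crux
means exhibiting a viscosity with Clay failure at which NO minimiser in `M` is axisymmetric —
a blow-up theorem plus a rigidity theorem about the undescribed set `M`. [folklore] -/
theorem cruxBody_iff_axisymmetricForm :
    (∀ ν : ℝ, 0 < ν → (∃ v₀ : EuclideanSpace ℝ (Fin 3) → EuclideanSpace ℝ (Fin 3), ContDiff ℝ (⊤ : ℕ∞) v₀ ∧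
      NSWave0.IsDivFree v₀ ∧ HasRapidSpatialDecay v₀ ∧
      ¬ ∃ (u : ℝ → EuclideanSpace ℝ (Fin 3) → EuclideanSpace ℝ (Fin 3)) (p : ℝ → EuclideanSpace ℝ (Fin 3) → ℝ),
        IsSmoothOnHalfSpace u ∧ IsSmoothOnHalfSpace p ∧ IsNavierStokesSolution ν 0 v₀ u p ∧ HasBoundedEnergy u) → (∀ N : ℕ, ∃ p : ℕ, N ≤ p ∧ 2 ≤ p ∧
      ∃ (u₀ : EuclideanSpace ℝ (Fin 3) → EuclideanSpace ℝ (Fin 3))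
        (g : HomSobolev (EuclideanSpace ℝ (Fin 3)) (EuclideanSpace ℂ (Fin 3)) (1 / 2 : ℝ)),
        IsMinimalBlowupDatum ν u₀ g ∧ ∀ x : EuclideanSpace ℝ (Fin 3),
          u₀ (WithLp.toLp 2 ![Real.cos (2 * Real.pi / p) * x 0 - Real.sin (2 * Real.pi / p) * x 1,
            Real.sin (2 * Real.pi / p) * x 0 + Real.cos (2 * Real.pi / p) * x 1, x 2]) =
          WithLp.toLp 2 ![Real.cos (2 * Real.pi / p) * u₀ x 0 - Real.sin (2 * Real.pi / p) * u₀ x 1,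
            Real.sin (2 * Real.pi / p) * u₀ x 0 + Real.cos (2 * Real.pi / p) * u₀ x 1, u₀ x 2])) ↔ ∀ ν : ℝ, 0 < ν → (∃ v₀ : EuclideanSpace ℝ (Fin 3) → EuclideanSpace ℝ (Fin 3), ContDiff ℝ (⊤ : ℕ∞) v₀ ∧
      NSWave0.IsDivFree v₀ ∧ HasRapidSpatialDecay v₀ ∧
      ¬ ∃ (u : ℝ → EuclideanSpace ℝ (Fin 3) → EuclideanSpace ℝ (Fin 3)) (p : ℝ → EuclideanSpace ℝ (Fin 3) → ℝ),
        IsSmoothOnHalfSpace u ∧ IsSmoothOnHalfSpace p ∧ IsNavierStokesSolution ν 0 v₀ u p ∧ HasBoundedEnergy u) → (∃ (u₀ : EuclideanSpace ℝ (Fin 3) → EuclideanSpace ℝ (Fin 3))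
        (g : HomSobolev (EuclideanSpace ℝ (Fin 3)) (EuclideanSpace ℂ (Fin 3)) (1 / 2 : ℝ)),
        IsMinimalBlowupDatum ν u₀ g ∧ ∀ (θ : ℝ) (x : EuclideanSpace ℝ (Fin 3)),
          u₀ (WithLp.toLp 2 ![Real.cos θ * x 0 - Real.sin θ * x 1, Real.sin θ * x 0 + Real.cos θ * x 1, x 2]) =
          WithLp.toLp 2 ![Real.cos θ * u₀ x 0 - Real.sin θ * u₀ x 1, Real.sin θ * u₀ x 0 + Real.cos θ * u₀ x 1, u₀ x 2]) := by
  constructor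
  · intro h ν hν hf
    exact Summit.NavierStokesRegularity.NavierStokesRegularity.Theorems.axisymmetricExtremality_pFoldToAxisymmetric_proof
      ν hν (h ν hν hf)
  · intro h ν hν hf N
    obtain ⟨u₀, g, hmin, hax⟩ := h ν hν hf
    exact ⟨max N 2, le_max_left _ _, le_max_right _ _, u₀, g, hmin, fun x => hax _ x⟩

/-! ## §2 Load-bearing hypotheses -/

/-- (H1) Dropping the antecedent asserts minimal blow-up data at EVERY viscosity. [folklore] -/
theorem withoutClayFailure_forces_minimalBlowup (h : ∀ ν : ℝ, 0 < ν → (∀ N : ℕ, ∃ p : ℕ, N ≤ p ∧ 2 ≤ p ∧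
      ∃ (u₀ : EuclideanSpace ℝ (Fin 3) → EuclideanSpace ℝ (Fin 3))
        (g : HomSobolev (EuclideanSpace ℝ (Fin 3)) (EuclideanSpace ℂ (Fin 3)) (1 / 2 : ℝ)),
        IsMinimalBlowupDatum ν u₀ g ∧ ∀ x : EuclideanSpace ℝ (Fin 3),
          u₀ (WithLp.toLp 2 ![Real.cos (2 * Real.pi / p) * x 0 - Real.sin (2 * Real.pi / p) * x 1,
            Real.sin (2 * Real.pi / p) * x 0 + Real.cos (2 * Real.pi / p) * x 1, x 2]) =
          WithLp.toLp 2 ![Real.cos (2 * Real.pi / p) * u₀ x 0 - Real.sin (2 * Real.pi / p) * u₀ x 1,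
            Real.sin (2 * Real.pi / p) * u₀ x 0 + Real.cos (2 * Real.pi / p) * u₀ x 1, u₀ x 2])) {ν : ℝ} (hν : 0 < ν) :
    ∃ (u₀ : EuclideanSpace ℝ (Fin 3) → EuclideanSpace ℝ (Fin 3)) (g : HomSobolev (EuclideanSpace ℝ (Fin 3)) (EuclideanSpace ℂ (Fin 3)) (1 / 2 : ℝ)), IsMinimalBlowupDatum ν u₀ g := by
  obtain ⟨p, -, -, u₀, g, hmin, -⟩ := h ν hν 0
  exact ⟨u₀, g, hmin⟩

/-- … hence a finite pure threshold `ρ_max^pure(ν) < ⊤` at every `ν > 0` (the norm of a bundled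
`Ḣ^{1/2}` class is finite). [folklore] -/
theorem withoutClayFailure_forces_thresholdFinite (h : ∀ ν : ℝ, 0 < ν → (∀ N : ℕ, ∃ p : ℕ, N ≤ p ∧ 2 ≤ p ∧
      ∃ (u₀ : EuclideanSpace ℝ (Fin 3) → EuclideanSpace ℝ (Fin 3))
        (g : HomSobolev (EuclideanSpace ℝ (Fin 3)) (EuclideanSpace ℂ (Fin 3)) (1 / 2 : ℝ)),
        IsMinimalBlowupDatum ν u₀ g ∧ ∀ x : EuclideanSpace ℝ (Fin 3),
          u₀ (WithLp.toLp 2 ![Real.cos (2 * Real.pi / p) * x 0 - Real.sin (2 * Real.pi / p) * x 1,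
            Real.sin (2 * Real.pi / p) * x 0 + Real.cos (2 * Real.pi / p) * x 1, x 2]) =
          WithLp.toLp 2 ![Real.cos (2 * Real.pi / p) * u₀ x 0 - Real.sin (2 * Real.pi / p) * u₀ x 1,
            Real.sin (2 * Real.pi / p) * u₀ x 0 + Real.cos (2 * Real.pi / p) * u₀ x 1, u₀ x 2])) {ν : ℝ} (hν : 0 < ν) :
    rusinSverakRhoMaxPure ν < ⊤ := by
  obtain ⟨u₀, g, -, -, -, hnorm, -⟩ := withoutClayFailure_forces_minimalBlowup h hν
  rw [← hnorm]
  exact enorm_lt_top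

/-- **`_false_without_ClayFailure` (conditional form, the only one available).** If a single
viscosity is Kato-regular, the crux WITHOUT its Clay-failure antecedent is false — whereas the crux
itself stays (vacuously) true there; unconditionally the antecedent-free statement can be neither
proved (it asserts blow-up) nor refuted (that is critical-space regularity) today. [folklore] -/
theorem minimalDatumPFold_false_without_clayFailure_of_katoRegular {ν : ℝ} (hν : 0 < ν) (hreg : (∀ (u₀ : EuclideanSpace ℝ (Fin 3) → EuclideanSpace ℝ (Fin 3))
        (g : HomSobolev (EuclideanSpace ℝ (Fin 3)) (EuclideanSpace ℂ (Fin 3)) (1 / 2 : ℝ)),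
        MemLp u₀ 3 (volume : Measure (EuclideanSpace ℝ (Fin 3))) → g.Represents (EuclideanSpace.complexify ∘ u₀) →
        IsWeaklyDivFree u₀ → HasGlobalKatoSolution ν u₀)) :
    ¬ ∀ ν : ℝ, 0 < ν → (∀ N : ℕ, ∃ p : ℕ, N ≤ p ∧ 2 ≤ p ∧
      ∃ (u₀ : EuclideanSpace ℝ (Fin 3) → EuclideanSpace ℝ (Fin 3))
        (g : HomSobolev (EuclideanSpace ℝ (Fin 3)) (EuclideanSpace ℂ (Fin 3)) (1 / 2 : ℝ)),
        IsMinimalBlowupDatum ν u₀ g ∧ ∀ x : EuclideanSpace ℝ (Fin 3),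
          u₀ (WithLp.toLp 2 ![Real.cos (2 * Real.pi / p) * x 0 - Real.sin (2 * Real.pi / p) * x 1,
            Real.sin (2 * Real.pi / p) * x 0 + Real.cos (2 * Real.pi / p) * x 1, x 2]) =
          WithLp.toLp 2 ![Real.cos (2 * Real.pi / p) * u₀ x 0 - Real.sin (2 * Real.pi / p) * u₀ x 1,
            Real.sin (2 * Real.pi / p) * u₀ x 0 + Real.cos (2 * Real.pi / p) * u₀ x 1, u₀ x 2]) := by
  intro h
  obtain ⟨u₀, g, hL3, hrep, hdiv, -, hno⟩ := withoutClayFailure_forces_minimalBlowup h hν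
  exact hno (hreg u₀ g hL3 hrep hdiv)

/-- Kato-regularity at `ν` is exactly `ρ_max^pure(ν) = ⊤`. [folklore] -/
theorem katoRegular_iff_threshold_top (ν : ℝ) : (∀ (u₀ : EuclideanSpace ℝ (Fin 3) → EuclideanSpace ℝ (Fin 3))
        (g : HomSobolev (EuclideanSpace ℝ (Fin 3)) (EuclideanSpace ℂ (Fin 3)) (1 / 2 : ℝ)),
        MemLp u₀ 3 (volume : Measure (EuclideanSpace ℝ (Fin 3))) → g.Represents (EuclideanSpace.complexify ∘ u₀) →
        IsWeaklyDivFree u₀ → HasGlobalKatoSolution ν u₀) ↔ rusinSverakRhoMaxPure ν = ⊤ := by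
  constructor
  · intro h
    apply top_unique
    apply le_sSup
    intro u₀ g hL3 hrep hdiv _
    exact h u₀ g hL3 hrep hdiv
  · intro h u₀ g hL3 hrep hdiv
    exact hasGlobalKatoSolution_of_lt_rusinSverakRhoMaxPure hL3 hrep hdiv (h ▸ enorm_lt_top)

/-- (H3') The crux's `2 ≤ p` is what keeps `N = 0, 1` honest: for `p = 1` the rotation is the
identity (`cos 2π = 1`, `sin 2π = 0`), so `1`-fold symmetry is no condition at all. [folklore] -/
theorem isPFold_one (u₀ : EuclideanSpace ℝ (Fin 3) → EuclideanSpace ℝ (Fin 3)) (x : EuclideanSpace ℝ (Fin 3)) :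
    u₀ (WithLp.toLp 2 ![Real.cos (2 * Real.pi / (1 : ℕ)) * x 0 - Real.sin (2 * Real.pi / (1 : ℕ)) * x 1,
        Real.sin (2 * Real.pi / (1 : ℕ)) * x 0 + Real.cos (2 * Real.pi / (1 : ℕ)) * x 1, x 2]) =
      WithLp.toLp 2 ![Real.cos (2 * Real.pi / (1 : ℕ)) * u₀ x 0 - Real.sin (2 * Real.pi / (1 : ℕ)) * u₀ x 1,
        Real.sin (2 * Real.pi / (1 : ℕ)) * u₀ x 0 + Real.cos (2 * Real.pi / (1 : ℕ)) * u₀ x 1, u₀ x 2] := by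
  have hrot : ∀ y : EuclideanSpace ℝ (Fin 3), (WithLp.toLp 2 ![Real.cos (2 * Real.pi / (1 : ℕ)) * y 0 - Real.sin (2 * Real.pi / (1 : ℕ)) * y 1,
      Real.sin (2 * Real.pi / (1 : ℕ)) * y 0 + Real.cos (2 * Real.pi / (1 : ℕ)) * y 1, y 2] : EuclideanSpace ℝ (Fin 3)) = y := by
    intro y
    ext i
    fin_cases i <;> simp
  rw [hrot, hrot]

/-! ## §4 Line `symmetric-gap`: clause mutation of the open stub's conclusion -/

/-- Without the BLOW-UP clause `¬ HasGlobalKatoSolution ν u₀`, the conclusion of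
`stub_symmGapClosing` is witnessed by the ZERO datum for every `p` and every `ε > 0`. [folklore] -/
theorem symmGap_conclusion_trivial_without_blowup (ν : ℝ) (p : ℕ) (ε : ℝ≥0∞) (hε : 0 < ε) :
    ∃ (u₀ : EuclideanSpace ℝ (Fin 3) → EuclideanSpace ℝ (Fin 3)) (g : HomSobolev (EuclideanSpace ℝ (Fin 3)) (EuclideanSpace ℂ (Fin 3)) (1 / 2 : ℝ)),
      MemLp u₀ 3 (volume : Measure (EuclideanSpace ℝ (Fin 3))) ∧ g.Represents (EuclideanSpace.complexify ∘ u₀) ∧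
      IsWeaklyDivFree u₀ ∧ ‖g‖ₑ < rusinSverakRhoMaxPure ν + ε ∧
      ∀ᵐ x ∂(volume : Measure (EuclideanSpace ℝ (Fin 3))),
      u₀ (WithLp.toLp 2 ![Real.cos (2 * Real.pi / p) * x 0 - Real.sin (2 * Real.pi / p) * x 1,
      Real.sin (2 * Real.pi / p) * x 0 + Real.cos (2 * Real.pi / p) * x 1,
      x 2]) = WithLp.toLp 2 ![Real.cos (2 * Real.pi / p) * u₀ x 0 - Real.sin (2 * Real.pi / p) * u₀ x 1,
      Real.sin (2 * Real.pi / p) * u₀ x 0 + Real.cos (2 * Real.pi / p) * u₀ x 1, u₀ x 2] := by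
  refine ⟨0, 0, ?_, ?_, ?_, ?_, ?_⟩
  · exact MemLp.zero
  · have h := HomSobolev.represents_zero (E := EuclideanSpace ℝ (Fin 3)) (F := EuclideanSpace ℂ (Fin 3)) (s := (1 / 2 : ℝ))
    have hc : (EuclideanSpace.complexify ∘ (0 : EuclideanSpace ℝ (Fin 3) → EuclideanSpace ℝ (Fin 3))) = (0 : EuclideanSpace ℝ (Fin 3) → EuclideanSpace ℂ (Fin 3)) := by
      funext x; simp only [Function.comp_apply, Pi.zero_apply, map_zero]
    rw [hc]; exact h
  · intro θ _; simp
  · rw [enorm_zero]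
    exact lt_of_lt_of_le hε le_add_self
  · refine Filter.Eventually.of_forall fun x => ?_
    ext i; fin_cases i <;> simp

/-- Without the EQUIVARIANCE clause, the conclusion of `stub_symmGapClosing` is the definition of the
threshold: if `ρ_max^pure(ν) < ⊤` then for every `ε > 0` there is an admissible datum WITHOUT a global
Kato solution of norm `< ρ_max^pure(ν) + ε` (unfold the `sSup`). With
`symmGap_conclusion_trivial_without_blowup`: the open content of the stub is exactly the COUPLING
near-minimal ∧ symmetric. [folklore] -/
theorem exists_blowupDatum_norm_lt_of_thresholdFinite {ν : ℝ} (hfin : rusinSverakRhoMaxPure ν < ⊤)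
    {ε : ℝ≥0∞} (hε : 0 < ε) :
    ∃ (u₀ : EuclideanSpace ℝ (Fin 3) → EuclideanSpace ℝ (Fin 3)) (g : HomSobolev (EuclideanSpace ℝ (Fin 3)) (EuclideanSpace ℂ (Fin 3)) (1 / 2 : ℝ)),
      MemLp u₀ 3 (volume : Measure (EuclideanSpace ℝ (Fin 3))) ∧ g.Represents (EuclideanSpace.complexify ∘ u₀) ∧
      IsWeaklyDivFree u₀ ∧ ¬ HasGlobalKatoSolution ν u₀ ∧ ‖g‖ₑ < rusinSverakRhoMaxPure ν + ε := by
  by_contra hcon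
  push Not at hcon
  have hle : rusinSverakRhoMaxPure ν + ε ≤ rusinSverakRhoMaxPure ν := by
    apply le_sSup
    intro u₀ g hL3 hrep hdiv hlt
    by_contra hno
    exact absurd hlt (not_lt.2 (hcon u₀ g hL3 hrep hdiv hno))
  exact absurd hle (not_le.2 (ENNReal.lt_add_right hfin.ne hε.ne'))

end Summit.NavierStokesRegularity.NavierStokesRegularity.Theorems.MinimalDatumPFold.Negative

end
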